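import Summits.FinalStateConjecture.FinalStateConjecture.Theses.TemporalBandLiouville
import HarnessLib.Audit

/-!
# Birth skeleton (BC3) — crux `Theses.TemporalBandLiouville.EternalExteriorStationary` (stmt-FinalStateConjecture-10170)

Registrar: planner-skel-stmt-FinalStateConjecture-10170-0, 2026-08-17 (route re-audit bin REPAIRABLE; published as
`Cruxes/EternalExteriorStationary/Lines/birth.lean`; BC3 of `run/shared/lean/lens3/_common/BC.md`).  The crux is FIXED
and concluded BY NAME:

  `Summit.FinalStateConjecture.FinalStateConjecture.Theses.TemporalBandLiouville.EternalExteriorStationary`  (X)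

X = ETERNAL EXTERIOR LIOUVILLE ("no vacuum breather"): a vacuum metric given by its components `G` in ONE global
harmonic coordinate system on the eternal excised cylinder `Kerr.region a r₀ = ℝ_t × {r(a,x⃗) > r₀}` — slices
uniformly spacelike, spacelike-inflow excision collar, `Ric(G) = 0`, wave gauge, every `C^k` norm of `G` and `‖G⁻¹‖`
bounded on the whole cylinder, asymptotically flat at STATIONARY rates `C/ρ, C/ρ², C/ρ³` uniformly in `t` (no
radiation in or out, ever) — is `t`-independent.  X is the rank-0 node of route TemporalBandLiouville (auto-crux,
2026-08-16: `closes … := hR hX` consumes X itself) and is SHARED verbatim with route LeakageWritesInInk.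

## The cut (two named stubs = the route's own two cruxes; composition kernel-checked)

The route's thesis IS a decomposition of X through one intermediate object, the TEMPORAL BAND (compact temporal
spectrum).  So the birth skeleton of X is the route's layer-1 plan, verbatim:

* `stub_bandFromNonradiation` — C1 = item stmt-FinalStateConjecture-10172 `BandFromNonradiation` (crux, rank 3;
  token-identical body): under the hypotheses of X alone, `G` is band-limited in `t` — every trace
  `s ↦ G (x + s e₀) v w` is the restriction of an entire `F` with `‖F z‖ ≤ C‖v‖‖w‖e^{b|Im z|}`, `b, C` uniform on the
  cylinder.  The ANALYTICITY-PRODUCING half ("Comech's hard task": mass gap ↦ leaky unstable trapping + red-shift).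
* `stub_bandLimitedLiouville` — C2 = item stmt-FinalStateConjecture-10171 `BandLimitedLiouville` (crux, rank 2, the
  route's hardest; token-identical body): under the hypotheses of X plus such a band, `G` is `t`-independent.  The
  ANALYTICITY-CONSUMING half (far zone: Rellich per frequency = support item `StaticZoneLiouville`; photon region:
  Tataru–Robbiano–Zuily–Hörmander time-analytic continuation wherever `∂_t` is timelike; ergo-belt: zero-energy
  pseudoconvexity or the Titchmarsh sieve — the open residue).

`EternalExteriorStationary_of : BandFromNonradiation → BandLimitedLiouville → EternalExteriorStationary` is PROVED below
(two applications of modus ponens: the three hypothesis bundles are syntactically identical and the conclusion of C1 is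
literally the extra hypothesis of C2).  Its binders are the route items BY NAME; the registered stubs are DEF-FREE,
fully-qualified token-identical copies of the two item bodies (so `propose --supports stmt-FinalStateConjecture-10170`
proofs match them textually and the items' `signature_norm` dedup applies), and
`eternalExteriorStationary_of_stubs` shows the hand-over is definitional.  The same term is the route's support item
`TargetOfCruxes` (stmt-FinalStateConjecture-10174; landed as `Theorems.TemporalBandLiouville.targetOfCruxes_proof`,
not imported here to keep this file independent of the Theorems build).

## Why this is an honest cut and not a costume (recorded for the critics)

* Neither stub is the crux or the summit in disguise: C2 is X WEAKENED by the band hypothesis, C1 only PRODUCES the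
  band.  Conversely both are CONSEQUENCES of X (`bandLimitedLiouville_of_eternal`, trivial; `bandFromNonradiation_of_eternal`,
  band `b = 0` from the `k = 0` bound — proved below, no sorry), so X ⟺ C1 ∧ C2 exactly: the cut loses nothing and
  neither piece is stronger than X.  Getting X from ONE stub needs the other, and each is open-problem sized; the BC3
  probes `stub → X`, `stub → FinalStateConjecture` by `exact? | simpa | simpa [·] | unfold; simpa | aesop` all FAIL
  (birth.md, raw table).
* The seam is "cut along an intermediate object", the standard shape of both registered decompositions of this shared
  crux: route LeakageWritesInInk cuts the SAME X along a STRIP instead of a BAND — `LeakageTimeAnalyticity` (item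
  10225: dark eternal exteriors are time-analytic in a uniform strip) → `TimeAnalyticLiouville` (item 10226: strip-analytic
  ones are stationary), composition `InkChain` (item 10228, landed `Theorems.inkChain_proof`).  Band ⇒ strip and
  strip-Liouville ⇒ band-Liouville are one-line complex analysis, so the two cuts are ordered piecewise
  (C1 ⇒ A, S ⇒ C2) and incomparable as pairs; this file registers the primary route's pair and leaves the ink pair to
  its own items (a lead on X may register `Lines/ink.lean` from them without touching this file).

Disproof used: none exists for this crux (`ledger crux ls stmt-FinalStateConjecture-10170`: no workfiles, no
`Disproof.lean`, payload `disproof_path` absent, 2026-08-17) — no `_false_without_` obligation to honour, no landed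
`Theorems/EternalExteriorStationary/Negative/*`.  Negatives index (1 entry, `not_UniformPhotonSphereChannels`, an ODE
channel estimate of route PhotonSphereChannels): unrelated to eternal Liouville statements; no stub instantiates it.
Refuter evidence on the item (EVIDENCE.md 2026-08-15, CAS j002064): X's hypothesis class is NON-VACUOUS (Schwarzschild in
Cook–Scheel horizon-penetrating harmonic coordinates, `a = 0, M = 1, r₀ = 1/2, δ = 1/4, c₀ = 1/8`) and clauses H5/H7 are
load-bearing — both stubs carry the full seven-clause antecedent verbatim, so they inherit this.
-/

set_option linter.dupNamespace false

noncomputable section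

namespace Summit.FinalStateConjecture.FinalStateConjecture.Cruxes.EternalExteriorStationary.Birth

/-! ## The two registered stubs (`sorry` only here; signatures def-free, fully qualified, token-identical to the items) -/

/-- **Registered stub 1 — C1, BAND FROM NON-RADIATION** (= route item `Theses.TemporalBandLiouville.BandFromNonradiation`,
stmt-FinalStateConjecture-10172, crux rank 3; body copied verbatim).  Under the seven hypothesis clauses of X alone
(`0 < r₀`; `IsMetricOn G (Kerr.region a r₀)`; uniformly spacelike slices and spacelike-inflow excision collar with
constants `c₀, δ`; `Ric = 0`; harmonic gauge; uniform `C^k` and `‖G⁻¹‖` bounds; stationary-rate fall-off), there are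
`b, C` such that every time trace `s ↦ G (x + s e₀) v w`, `x` in the cylinder, is the restriction to `ℝ` of an entire
function bounded by `C‖v‖‖w‖ e^{b|Im z|}` (Paley–Wiener–Bernstein class: temporal spectrum in `[-b, b]`).
Why plausibly true: an eternal two-sided-bounded non-radiating solution has no source of high temporal frequencies —
backwards they come from `𝓘⁻` (excluded by the incoming-stationary fall-off), from the horizon side (excluded by the
backward blue-shift against two-sided `C^k` bounds when `κ > 0`, the collar clause) or live on the trapped set
(unstable trapping cannot hold them eternally); autonomy + Titchmarsh support inflation is the proposed upgrade from
`O(λ^-∞)` tails to a compact spectrum.  Why it might fail (route docstring): semiclassics gives decay, not a band; a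
nonlinear breather generically carries all harmonics, so C1 most likely fails whenever X does; no red-shift leg for
extremal collars.  Size: open-problem.  Sources: arXiv:1404.7036, arXiv:1305.1723, arXiv:1402.7034, arXiv:0811.0354,
doi:10.1142/12602, arXiv:1810.09047. -/
theorem stub_bandFromNonradiation :
    ∀ (a r₀ : ℝ) (G : Literature.Geometry.Lorentzian.E4 → Literature.Geometry.Lorentzian.E4 →L[ℝ] Literature.Geometry.Lorentzian.E4 →L[ℝ] ℝ), (0 < r₀ ∧ Literature.Geometry.Lorentzian.MetricCoord.IsMetricOn G (Literature.Geometry.Lorentzian.Kerr.region a r₀ : Set Literature.Geometry.Lorentzian.E4) ∧ (∃ c₀ δ : ℝ, 0 < c₀ ∧ 0 < δ ∧ ∀ x ∈ Literature.Geometry.Lorentzian.Kerr.region a r₀, (Literature.Geometry.Lorentzian.E4.dx 0) (Literature.Geometry.Lorentzian.MetricCoord.sharpAt G x (Literature.Geometry.Lorentzian.E4.dx 0)) ≤ -c₀ ∧ (Literature.Geometry.Lorentzian.Kerr.radius a x < r₀ + δ → (fderiv ℝ (Literature.Geometry.Lorentzian.Kerr.radius a) x) (Literature.Geometry.Lorentzian.MetricCoord.sharpAt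 G x (fderiv ℝ (Literature.Geometry.Lorentzian.Kerr.radius a) x)) ≤ -c₀ ∧ c₀ ≤ (Literature.Geometry.Lorentzian.E4.dx 0) (Literature.Geometry.Lorentzian.MetricCoord.sharpAt G x (fderiv ℝ (Literature.Geometry.Lorentzian.Kerr.radius a) x)))) ∧ (∀ x ∈ Literature.Geometry.Lorentzian.Kerr.region a r₀, Literature.Geometry.Lorentzian.MetricCoord.ricAt G x = 0) ∧ (∀ x ∈ Literature.Geometry.Lorentzian.Kerr.region a r₀, ∑ β : Fin 4, Literature.Geometry.Lorentzian.MetricCoord.chrAt G x (Literature.Geometry.Lorentzian.MetricCoord.sharpAt G x (Literature.Geometry.Lorentzian.E4.dx β)) (Literature.Geometry.Lorentzian.E4.basisVector β) = 0) ∧ (∀ k : ℕ, ∃ C : ℝ, ∀ x ∈ Literature.Geometry.Lorentzian.Kerr.region a r₀, ‖iteratedFDeriv ℝ k G x‖ ≤ C ∧ ‖Literature.Geometry.Lorentzian.MetricCoord.sharpAt G x‖ ≤ C) ∧ (∃ C : ℝ, ∀ x ∈ Literature.Geometry.Lorentzian.Kerr.region a r₀, ‖G x - Literature.Geometry.Lorentzian.Minkowski.bilin‖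 ≤ C / Literature.Geometry.Lorentzian.E4.spatialNorm x ∧ ‖iteratedFDeriv ℝ 1 G x‖ ≤ C / Literature.Geometry.Lorentzian.E4.spatialNorm x ^ 2 ∧ ‖iteratedFDeriv ℝ 2 G x‖ ≤ C / Literature.Geometry.Lorentzian.E4.spatialNorm x ^ 3)) → (∃ b C : ℝ, ∀ x ∈ Literature.Geometry.Lorentzian.Kerr.region a r₀, ∀ v w : Literature.Geometry.Lorentzian.E4, ∃ F : ℂ → ℂ, Differentiable ℂ F ∧ (∀ z : ℂ, ‖F z‖ ≤ C * ‖v‖ * ‖w‖ * Real.exp (b * |z.im|)) ∧ ∀ s : ℝ, F (s : ℂ) = ((G (x + s • Literature.Geometry.Lorentzian.E4.basisVector 0) v w : ℝ) : ℂ)) := by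
  sorry

/-- **Registered stub 2 — C2, FINITE-BAND LIOUVILLE** (= route item `Theses.TemporalBandLiouville.BandLimitedLiouville`,
stmt-FinalStateConjecture-10171, crux rank 2 — the route's hardest and most informative node; body copied verbatim).
Under the seven hypothesis clauses of X, if moreover `G` is band-limited in `t` (conclusion of stub 1 as hypothesis),
then `G (x + s e₀) = G x` on the cylinder.  Engines (route rationale): `h := ∂_t G` solves the linearisation of the
autonomous reduced vacuum system about `G` EXACTLY; far zone — Fourier in `t` + Rellich–Vekua per frequency kills `h`
near infinity (the support item `StaticZoneLiouville`, strip analyticity suffices there; Rellich's lemma vendored,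
`Literature/Analysis/PDE/RellichLemma.lean`); photon region — the band makes `G, h` entire in `t`, and for operators
analytic in `t` Tataru–Robbiano–Zuily–Hörmander continuation crosses every non-characteristic surface where `∂_t` is
timelike, no convexity needed; ergo-belt (`∂_t` spacelike, `a ≠ 0`) — pseudoconvexity only against ZERO-ENERGY null
bicharacteristics (Ionescu–Klainerman's T-conditional pseudoconvexity, verified near Kerr) or the Titchmarsh sieve on the
degree-8 polynomialised Einstein operator (top temporal germ in the cancellation variety; Kerr–Schild germs left to
real-frequency mode rigidity).  Why it might fail (route docstring): neither engine closes a general rotating belt —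
T-pseudoconvexity is known only near Kerr, the sieve leaves Kerr–Schild / imaginary-homothetic top germs; a
band-limited (even trigonometric-polynomial) AF vacuum breather would refute it.  Size: open-problem.  Sources:
arXiv:1504.04592, doi:10.1088/0264-9381/27/5/055007, doi:10.1007/s00220-010-1072-1, doi:10.1007/s00222-008-0146-6,
doi:10.1080/03605309508821117, doi:10.4171/jems/854, arXiv:1810.09047, arXiv:2109.02187, arXiv:1302.6902. -/
theorem stub_bandLimitedLiouville :
    ∀ (a r₀ : ℝ) (G : Literature.Geometry.Lorentzian.E4 → Literature.Geometry.Lorentzian.E4 →L[ℝ] Literature.Geometry.Lorentzian.E4 →L[ℝ] ℝ), (0 < r₀ ∧ Literature.Geometry.Lorentzian.MetricCoord.IsMetricOn G (Literature.Geometry.Lorentzian.Kerr.region a r₀ : Set Literature.Geometry.Lorentzian.E4) ∧ (∃ c₀ δ : ℝ, 0 < c₀ ∧ 0 < δ ∧ ∀ x ∈ Literature.Geometry.Lorentzian.Kerr.region a r₀, (Literature.Geometry.Lorentzian.E4.dx 0) (Literature.Geometry.Lorentzian.MetricCoord.sharpAt G x (Literature.Geometry.Lorentzian.E4.dx 0))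 ≤ -c₀ ∧ (Literature.Geometry.Lorentzian.Kerr.radius a x < r₀ + δ → (fderiv ℝ (Literature.Geometry.Lorentzian.Kerr.radius a) x) (Literature.Geometry.Lorentzian.MetricCoord.sharpAt G x (fderiv ℝ (Literature.Geometry.Lorentzian.Kerr.radius a) x)) ≤ -c₀ ∧ c₀ ≤ (Literature.Geometry.Lorentzian.E4.dx 0) (Literature.Geometry.Lorentzian.MetricCoord.sharpAt G x (fderiv ℝ (Literature.Geometry.Lorentzian.Kerr.radius a) x)))) ∧ (∀ x ∈ Literature.Geometry.Lorentzian.Kerr.region a r₀, Literature.Geometry.Lorentzian.MetricCoord.ricAt G x = 0) ∧ (∀ x ∈ Literature.Geometry.Lorentzian.Kerr.region a r₀, ∑ β : Fin 4, Literature.Geometry.Lorentzian.MetricCoord.chrAt G x (Literature.Geometry.Lorentzian.MetricCoord.sharpAt G x (Literature.Geometry.Lorentzian.E4.dx β)) (Literature.Geometry.Lorentzian.E4.basisVector β) = 0) ∧ (∀ k : ℕ, ∃ C : ℝ, ∀ x ∈ Literature.Geometry.Lorentzian.Kerr.region a r₀, ‖iteratedFDeriv ℝ k G x‖ ≤ C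 ∧ ‖Literature.Geometry.Lorentzian.MetricCoord.sharpAt G x‖ ≤ C) ∧ (∃ C : ℝ, ∀ x ∈ Literature.Geometry.Lorentzian.Kerr.region a r₀, ‖G x - Literature.Geometry.Lorentzian.Minkowski.bilin‖ ≤ C / Literature.Geometry.Lorentzian.E4.spatialNorm x ∧ ‖iteratedFDeriv ℝ 1 G x‖ ≤ C / Literature.Geometry.Lorentzian.E4.spatialNorm x ^ 2 ∧ ‖iteratedFDeriv ℝ 2 G x‖ ≤ C / Literature.Geometry.Lorentzian.E4.spatialNorm x ^ 3)) → (∃ b C : ℝ, ∀ x ∈ Literature.Geometry.Lorentzian.Kerr.region a r₀, ∀ v w : Literature.Geometry.Lorentzian.E4, ∃ F : ℂ → ℂ, Differentiable ℂ F ∧ (∀ z : ℂ, ‖F z‖ ≤ C * ‖v‖ * ‖w‖ * Real.exp (b * |z.im|)) ∧ ∀ s : ℝ, F (s : ℂ) = ((G (x + s • Literature.Geometry.Lorentzian.E4.basisVector 0) v w : ℝ) : ℂ)) → ∀ x ∈ Literature.Geometry.Lorentzian.Kerr.region a r₀, ∀ s : ℝ, G (x + s • Literature.Geometry.Lorentzian.E4.basisVector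 0) = G x := by
  sorry

/-! ## The composition: the crux BY NAME from the two stub statements (real proof, no `sorry`) -/

/-- **X from C1 and C2** (= the route's `TargetOfCruxes`, two applications of modus ponens).  Given the hypothesis
bundle `hG` of X for `(a, r₀, G)`, C1 yields the temporal band `hB a r₀ G hG`; C2 applied to the same bundle and that
band yields `t`-independence.  Binders are the route items by name; their bodies are token-identical to the two
registered stub signatures (see `eternalExteriorStationary_of_stubs`). -/
theorem EternalExteriorStationary_of
    (hB : Theses.TemporalBandLiouville.BandFromNonradiation)
    (hL : Theses.TemporalBandLiouville.BandLimitedLiouville) :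
    Theses.TemporalBandLiouville.EternalExteriorStationary := by
  intro a r₀ G hG
  exact hL a r₀ G hG (hB a r₀ G hG)

/-- The crux by name, closed modulo the two registered stubs (the hand-over `stub ↦ item` is definitional: `exact`). -/
theorem eternalExteriorStationary_of_stubs : Theses.TemporalBandLiouville.EternalExteriorStationary :=
  EternalExteriorStationary_of stub_bandFromNonradiation stub_bandLimitedLiouville

/-! ## Sanity of the cut: both stubs are consequences of X (so X ⟺ C1 ∧ C2; neither piece is stronger than the crux) -/

/-- X → C2: C2 is X weakened by an extra (band) hypothesis. -/
theorem bandLimitedLiouville_of_eternal (hX : Theses.TemporalBandLiouville.EternalExteriorStationary) :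
    Theses.TemporalBandLiouville.BandLimitedLiouville :=
  fun a r₀ G hG _ => hX a r₀ G hG

/-- X → C1 with `b = 0`: a `t`-independent `G` has constant time traces, which extend to constant entire functions
bounded by `C₀‖v‖‖w‖` where `C₀` is the `k = 0` constant of the uniform `C^k` clause (`‖iteratedFDeriv ℝ 0 G x‖ = ‖G x‖`). -/
theorem bandFromNonradiation_of_eternal (hX : Theses.TemporalBandLiouville.EternalExteriorStationary) :
    Theses.TemporalBandLiouville.BandFromNonradiation := by
  intro a r₀ G hG
  obtain ⟨C, hC⟩ := hG.2.2.2.2.2.1 0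
  refine ⟨0, C, fun x hx v w => ⟨fun _ => ((G x v w : ℝ) : ℂ), differentiable_const _, fun z => ?_, fun s => ?_⟩⟩
  · have h0 : ‖G x‖ ≤ C := by
      have h := (hC x hx).1
      rwa [norm_iteratedFDeriv_zero] at h
    have h1 : ‖G x v w‖ ≤ C * ‖v‖ * ‖w‖ :=
      calc ‖G x v w‖ ≤ ‖G x v‖ * ‖w‖ := (G x v).le_opNorm w
        _ ≤ ‖G x‖ * ‖v‖ * ‖w‖ := by gcongr; exact (G x).le_opNorm v
        _ ≤ C * ‖v‖ * ‖w‖ := by gcongr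
    simpa [Complex.norm_real] using h1
  · simp only [hX a r₀ G hG x hx s]

end Summit.FinalStateConjecture.FinalStateConjecture.Cruxes.EternalExteriorStationary.Birth

end
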